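import Summits.CriticalPhenomena.PercolationContinuityZ3.Theorems.PercNearOneGluingNoHeavyLowerTailCILIsolatedObserver
import HarnessLib

/-!
# `NoHeavyLowerTail` (stmt-CriticalPhenomena-4575) — CIL when the observer's Steiner neighbours are at
# least as heavy as the lightest relay

Support file for the crux `NoHeavyLowerTail` (routes `PercNearOneGluing`, `PercNearOneGluingNoHeavy`;
`--supports stmt-CriticalPhenomena-4575`), blob-quotient / cumulative-isolation line (depth prover
`nh-dp-blobmono`), continuing `…CILIsolatedObserver.lean`.  No definitions, no named facts, no sorries.

Notation as there: `μ = prodBernoulli w` on `Fin n`, relays `A`, observer `o ∉ A`, `N = |{x ∈ A : o ↔ x}|`,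
`π(a) = {x ∈ A : a ↔ x}`, level `j`; CIL_j is `∃ a ∈ A, μ{1 ≤ N ≤ j} ≤ μ{|π(a)| ≤ j}` (registered stub
`stub_cumulativeIsolation`).

`…CILIsolatedObserver.lean` proves CIL at every level when every positive-weight neighbour of `o` is a relay
(Kozma–Nitzan's Theorem 8, event form).  The proof of Theorem 8 uses, for each nonempty star `B` of open
pairs at `o`, only ONE vertex `v ∈ B` whose cluster in `G ∖ {o}` has the property at least as often as the
witness's; so NON-relay neighbours are harmless as long as they are, in `G ∖ {o}`, at least as likely to carry
a heavy cluster as the lightest relay.  This file records that enlargement (not in the paper):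

* `thm8_event_subfamily` — Theorem 8 with the witness confined to a sub-family `A ⊆ A⁺` dominating the
  minimum of `μ_{G∖o}(P(C(·)))` over `A⁺` (`o` isolated in `G ∖ A⁺`).
* `cumulativeIsolation_of_heavySteinerNeighbours` — **CIL_j (pre-FKG form) whenever every positive-weight
  neighbour `u ∉ A` of `o` satisfies `μ_{G∖o}(|C(u) ∩ A| ≥ j+1) ≥ μ_{G∖o}(|π(a)| ≥ j+1)` for some relay `a`**;
  witness = a relay minimising `μ_{G∖o}(|π(·)| ≥ j+1)`.  The first configuration outside the class is an
  observer with a LIGHT Steiner neighbour (its cluster off `o` is heavy less often than every relay's) —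
  e.g. `o` hanging off a loosely attached Steiner hub; two or more "private" Steiner neighbours already
  pose the common-witness problem of Kozma–Nitzan §3.2 (their Theorem 5 handles one).
-/

noncomputable section

namespace Summit.CriticalPhenomena.PercolationContinuityZ3.Theorems

open MeasureTheory Set Literature.Probability.LatticeModels Literature.Probability.Percolation
open scoped Classical BigOperators

variable {n : ℕ}

/-- **Theorem 8 with the witness confined to a sub-family.**  Let `A ⊆ A⁺` be finite vertex sets with
`o ∉ A⁺`, every pair `s(o,u)` with `u ∉ A⁺`, `u ≠ o` of weight `0`, `A ≠ ∅`, and suppose every `u ∈ A⁺`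
is dominated by some `a ∈ A` in `G ∖ {o}`: `μ_{G∖o}(P(C(a))) ≤ μ_{G∖o}(P(C(u)))` (`P` a monotone property
of vertex sets).  Then some `a ∈ A` (namely a minimiser of `μ_{G∖o}(P(C(·)))` over `A`) satisfies
`μ(P(C(a)), o ↔ A⁺) ≤ μ(P(C(o)), o ↔ A⁺)`.  Proof = the proof of
`Literature.….KozmaNitzan2024_thm8_event` (stars `σ_B`, `∅ ≠ B ⊆ A⁺`; Lemma 5 for cluster properties with
any `v ∈ B`, the domination hypothesis supplying Lemma 5's comparison). [folklore] -/
theorem thm8_event_subfamily {V : Type*} [Fintype V] (w : Sym2 V → unitInterval)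
    (A Aplus : Finset V) (o : V) (P : Set V → Prop) (hP : ∀ S T : Set V, S ⊆ T → P S → P T)
    (hA : A.Nonempty) (hsub : A ⊆ Aplus) (hoA : o ∉ Aplus)
    (hiso : ∀ u, u ≠ o → u ∉ Aplus → w s(o, u) = 0)
    (hdom : ∀ u ∈ Aplus, ∃ a ∈ A,
      (prodBernoulli w).real {ω | P {y | ω ∈ openConnIn ({o}ᶜ : Set V) a y}} ≤
        (prodBernoulli w).real {ω | P {y | ω ∈ openConnIn ({o}ᶜ : Set V) u y}}) :
    ∃ a ∈ A, (prodBernoulli w).real ({ω | P (openCluster ω a)} ∩ ⋃ a' ∈ Aplus, openConn o a') ≤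
      (prodBernoulli w).real ({ω | P (openCluster ω o)} ∩ ⋃ a' ∈ Aplus, openConn o a') := by
  classical
  set μ := prodBernoulli w with hμ
  -- `a₀` minimising `P_{G ∖ {0}}(P(C(a)))` over `A`; by `hdom` it minimises over `A⁺` as well
  obtain ⟨a₀, ha₀, hmin⟩ := A.exists_min_image
    (fun a => μ.real {ω | P {y | ω ∈ openConnIn ({o}ᶜ : Set V) a y}}) hA
  have hmin' : ∀ u ∈ Aplus, μ.real {ω | P {y | ω ∈ openConnIn ({o}ᶜ : Set V) a₀ y}} ≤
      μ.real {ω | P {y | ω ∈ openConnIn ({o}ᶜ : Set V) u y}} := by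
    intro u hu
    obtain ⟨a, ha, hau⟩ := hdom u hu
    exact (hmin a ha).trans hau
  refine ⟨a₀, ha₀, ?_⟩
  have ha₀o : a₀ ≠ o := fun h => hoA (h ▸ hsub ha₀)
  rw [KNPreFKG.real_eq_sum_inter_starEvent w Aplus o hoA hiso ({ω | P (openCluster ω a₀)} ∩ _),
    KNPreFKG.real_eq_sum_inter_starEvent w Aplus o hoA hiso ({ω | P (openCluster ω o)} ∩ _)]
  refine Finset.sum_le_sum fun B hB => ?_
  have hBA : B ⊆ Aplus := Finset.mem_powerset.1 hB
  rcases B.eq_empty_or_nonempty with rfl | ⟨v, hv⟩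
  · -- under `σ_∅`, `0 ↮ A⁺`: the `B = ∅` term vanishes
    have h0 : ({ω | P (openCluster ω a₀)} ∩ ⋃ a' ∈ Aplus, openConn o a') ∩
        starEvent o ↑(∅ : Finset V) = (∅ : Set (BondConfig V)) := by
      ext ω
      simp only [mem_inter_iff, mem_iUnion, exists_prop, mem_empty_iff_false, iff_false, not_and]
      rintro ⟨-, a', ha', hoa'⟩ hσ
      rw [Finset.coe_empty] at hσ
      exact KNPreFKG.not_reachable_of_mem_starEvent_empty hσ (fun h => hoA (h ▸ ha')) hoa'
    rw [h0, measureReal_empty]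
    exact measureReal_nonneg
  · -- `B ≠ ∅`: Lemma 5 (cluster form) with any `v ∈ B`, and `σ_B ⊆ {0 ↔ v} ⊆ {0 ↔ A⁺}`
    have hvo : v ≠ o := fun h => hoA (h ▸ hBA hv)
    have L5 := KozmaNitzan2024_lemma5_cluster w o a₀ v (↑B) P hP ha₀o hvo (Finset.mem_coe.2 hv)
      (hmin' v (hBA hv))
    have hσU : starEvent o (↑B : Set V) ⊆ ⋃ a' ∈ Aplus, (openConn o a' : Set (BondConfig V)) := by
      intro ω hσ
      have hov : s(o, v) ∈ ω :=
        ((mem_starEvent_iff o (↑B) ω).1 hσ v hvo).2 (Finset.mem_coe.2 hv)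
      have hadj : (openGraph ω).Adj o v := (openGraph_adj ω o v).2 ⟨hov, hvo.symm⟩
      exact mem_iUnion₂.2 ⟨v, hBA hv, hadj.reachable⟩
    calc μ.real (({ω | P (openCluster ω a₀)} ∩ ⋃ a' ∈ Aplus, openConn o a') ∩ starEvent o ↑B)
        ≤ μ.real ({ω | P (openCluster ω a₀)} ∩ starEvent o ↑B) :=
          measureReal_mono fun ω ⟨⟨h1, _⟩, h2⟩ => ⟨h1, h2⟩
      _ ≤ μ.real ({ω | P (openCluster ω o)} ∩ starEvent o ↑B) := L5
      _ ≤ μ.real (({ω | P (openCluster ω o)} ∩ ⋃ a' ∈ Aplus, openConn o a') ∩ starEvent o ↑B) :=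
          measureReal_mono fun ω ⟨h1, h2⟩ => ⟨⟨h1, hσU h2⟩, h2⟩

/-- **CIL when every Steiner neighbour of the observer is at least as heavy as the lightest relay.**
Let `o ∉ A`, `A ≠ ∅`, and suppose every positive-weight neighbour `u ∉ A` of `o` satisfies, in the graph
with `o` deleted, `μ_{G∖o}(|C(u) ∩ A| ≥ j+1) ≥ μ_{G∖o}(|π(a)| ≥ j+1)` for SOME relay `a` (e.g. for the
lightest one).  Then CIL holds at level `j` in pre-FKG form: some relay `a₀ ∈ A` has
`μ{1 ≤ N ≤ j} ≤ μ({o ↔ A} ∩ {|π(a₀)| ≤ j})`.  The case with no positive-weight Steiner neighbour is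
`cumulativeIsolation_preFKG_of_isolatedObserver`. [folklore] -/
theorem cumulativeIsolation_of_heavySteinerNeighbours (w : Sym2 (Fin n) → unitInterval)
    (A : Finset (Fin n)) (o : Fin n) (j : ℕ) (hA : A.Nonempty) (hoA : o ∉ A)
    (hheavy : ∀ u, u ≠ o → u ∉ A → w s(o, u) ≠ 0 → ∃ a ∈ A,
      (prodBernoulli w).real {ω : BondConfig (Fin n) |
          j + 1 ≤ (A.filter fun x => ω ∈ openConnIn ({o}ᶜ : Set (Fin n)) a x).card} ≤
        (prodBernoulli w).real {ω : BondConfig (Fin n) |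
          j + 1 ≤ (A.filter fun x => ω ∈ openConnIn ({o}ᶜ : Set (Fin n)) u x).card}) :
    ∃ a ∈ A,
      (prodBernoulli w).real {ω : BondConfig (Fin n) |
          1 ≤ (A.filter fun x => ω ∈ openConn o x).card ∧
            (A.filter fun x => ω ∈ openConn o x).card ≤ j} ≤
        (prodBernoulli w).real ((⋃ a' ∈ A, (openConn o a' : Set (BondConfig (Fin n)))) ∩
          {ω : BondConfig (Fin n) | (A.filter fun x => ω ∈ openConn a x).card ≤ j}) := by
  set μ := prodBernoulli w with hμ
  -- the monotone cluster property `|C ∩ A| ≥ j+1`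
  set P : Set (Fin n) → Prop := fun S => j + 1 ≤ (A.filter fun x => x ∈ S).card with hP
  have hPmono : ∀ S T : Set (Fin n), S ⊆ T → P S → P T :=
    fun S T hST hS => le_trans hS (card_filter_mem_mono A hST)
  -- `A⁺` = relays together with the positive-weight neighbours of `o`
  set Aplus : Finset (Fin n) := A ∪ Finset.univ.filter (fun u => u ≠ o ∧ w s(o, u) ≠ 0) with hAplus
  have hsub : A ⊆ Aplus := Finset.subset_union_left
  have hoAplus : o ∉ Aplus := by
    intro h
    rcases Finset.mem_union.1 h with h | h
    · exact hoA h
    · exact (Finset.mem_filter.1 h).2.1 rfl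
  have hiso : ∀ u, u ≠ o → u ∉ Aplus → w s(o, u) = 0 := by
    intro u huo hu
    by_contra hne
    exact hu (Finset.mem_union.2 (Or.inr (Finset.mem_filter.2 ⟨Finset.mem_univ _, huo, hne⟩)))
  have hPset : ∀ (u : Fin n) (ω : BondConfig (Fin n)),
      P {y | ω ∈ openConnIn ({o}ᶜ : Set (Fin n)) u y} ↔
        j + 1 ≤ (A.filter fun x => ω ∈ openConnIn ({o}ᶜ : Set (Fin n)) u x).card := by
    intro u ω
    simp only [hP, mem_setOf_eq]
  have hdom : ∀ u ∈ Aplus, ∃ a ∈ A,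
      μ.real {ω | P {y | ω ∈ openConnIn ({o}ᶜ : Set (Fin n)) a y}} ≤
        μ.real {ω | P {y | ω ∈ openConnIn ({o}ᶜ : Set (Fin n)) u y}} := by
    intro u hu
    by_cases huA : u ∈ A
    · exact ⟨u, huA, le_rfl⟩
    · have hu' : u ∈ Finset.univ.filter (fun u => u ≠ o ∧ w s(o, u) ≠ 0) :=
        (Finset.mem_union.1 hu).resolve_left huA
      obtain ⟨-, huo, hne⟩ := Finset.mem_filter.1 hu'
      obtain ⟨a, ha, hle⟩ := hheavy u huo huA hne
      refine ⟨a, ha, ?_⟩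
      simp only [hPset]
      exact hle
  obtain ⟨a₀, ha₀, h8⟩ := thm8_event_subfamily w A Aplus o P hPmono hA hsub hoAplus hiso hdom
  refine ⟨a₀, ha₀, ?_⟩
  set R : Set (BondConfig (Fin n)) := ⋃ a' ∈ A, (openConn o a' : Set (BondConfig (Fin n))) with hR
  set Rp : Set (BondConfig (Fin n)) := ⋃ a' ∈ Aplus, (openConn o a' : Set (BondConfig (Fin n))) with hRp
  set Uo : Set (BondConfig (Fin n)) := {ω | P (openCluster ω o)} with hUo
  set Ua : Set (BondConfig (Fin n)) := {ω | P (openCluster ω a₀)} with hUa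
  have hmemR : ∀ ω, ω ∈ R ↔ 1 ≤ (A.filter fun x => ω ∈ openConn o x).card := by
    intro ω
    rw [Nat.succ_le_iff, Finset.card_pos, Finset.filter_nonempty_iff]
    simp only [hR, mem_iUnion, exists_prop]
  have hRRp : R ⊆ Rp := by
    intro ω hω
    simp only [hR, hRp, mem_iUnion, exists_prop] at hω ⊢
    obtain ⟨a', ha', h⟩ := hω
    exact ⟨a', hsub ha', h⟩
  -- `Uo ⊆ R` (a heavy observer cluster meets `A`)
  have hUoR : Uo ⊆ R := by
    intro ω hω
    rw [hmemR]
    simp only [hUo, hP, mem_setOf_eq, card_filter_mem_openCluster] at hω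
    omega
  -- `{1 ≤ N ≤ j} = R ∖ Uo`
  have hL : {ω : BondConfig (Fin n) | 1 ≤ (A.filter fun x => ω ∈ openConn o x).card ∧
      (A.filter fun x => ω ∈ openConn o x).card ≤ j} = R \ Uo := by
    ext ω
    simp only [mem_setOf_eq, mem_sdiff, hmemR, hUo, hP, card_filter_mem_openCluster, not_le]
    omega
  have hT : R \ Ua ⊆ R ∩ {ω : BondConfig (Fin n) | (A.filter fun x => ω ∈ openConn a₀ x).card ≤ j} := by
    rintro ω ⟨hωR, hωU⟩
    refine ⟨hωR, ?_⟩
    simp only [hUa, hP, mem_setOf_eq, card_filter_mem_openCluster, not_le] at hωU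
    simp only [mem_setOf_eq]
    omega
  have e1 : μ.real (R ∩ Uo) + μ.real (R \ Uo) = μ.real R :=
    measureReal_inter_add_sdiff (MeasurableSet.of_discrete : MeasurableSet Uo) (measure_ne_top _ _)
  have e2 : μ.real (R ∩ Ua) + μ.real (R \ Ua) = μ.real R :=
    measureReal_inter_add_sdiff (MeasurableSet.of_discrete : MeasurableSet Ua) (measure_ne_top _ _)
  -- `μ(R ∩ Ua) ≤ μ(Ua ∩ R⁺) ≤ μ(Uo ∩ R⁺) ≤ μ(R ∩ Uo)`
  have hchain : μ.real (R ∩ Ua) ≤ μ.real (R ∩ Uo) := by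
    calc μ.real (R ∩ Ua) ≤ μ.real (Ua ∩ Rp) :=
          measureReal_mono fun ω ⟨h1, h2⟩ => ⟨h2, hRRp h1⟩
      _ ≤ μ.real (Uo ∩ Rp) := h8
      _ ≤ μ.real (R ∩ Uo) := measureReal_mono fun ω ⟨h1, _⟩ => ⟨hUoR h1, h1⟩
  rw [hL]
  calc μ.real (R \ Uo) = μ.real R - μ.real (R ∩ Uo) := by linarith
    _ ≤ μ.real R - μ.real (R ∩ Ua) := by linarith
    _ = μ.real (R \ Ua) := by linarith
    _ ≤ μ.real (R ∩ {ω : BondConfig (Fin n) | (A.filter fun x => ω ∈ openConn a₀ x).card ≤ j}) :=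
        measureReal_mono hT

end Summit.CriticalPhenomena.PercolationContinuityZ3.Theorems

end
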